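import Summits.BirchSwinnertonDyer.Rank1Residual.X11b.KolyvaginShaOrderAtPrimeOfGross1991
import Summits.BirchSwinnertonDyer.Rank1Residual.X11b.KolyvaginShaOrderAtPrimeIndexOfGross1991
import Summits.BirchSwinnertonDyer.Rank1Residual.X11b.Three.KolyvaginShaThreeDescentToQ
import HarnessLib

/-!
# Kolyvagin's ORDER bound over `ℚ` at ONE odd surjective prime `p` — `ord_p #Ш(E/ℚ)[p^∞] ≤ 2 ·
# ord_p [E(K) : ℤ y_K]` — WITHOUT the Kodaira–Néron sub-class (KN_p), modulo TWO NAMED facts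
# (Gross 1991 Prop. 3.7 (2) and §6 / [GZ86, III (3.1)] BY NAME) and the Cassels–Tate inputs

Cell `b2b-bsdres`, team x11b3 (N8/O2 = X11b @ 3); seat x11b3-p2 GEN 54 (unit claimed D-0075 →
BSD:K2/P4 «Kolyvagin-in-kernel»; the ladder-P4 ORDER form DESCENDED TO `ℚ`).  Summit-side
THEOREM-ONLY file (no definition, no named fact, no `sorry`); `K : Type`; a general odd prime `p`.

HONEST FRAMING (cell `b2b-bsdres`, run/shared/lean/b2b/bsd-rank1-residual/, verbatim in every
file): the goal of the cell is to DELETE the COMBINATION-SHAPED residual classes of the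
Birch–Swinnerton-Dyer formula for ALL analytic-rank `≤ 1` elliptic curves over `ℚ` — "full BSD
formula for every rank `≤ 1` curve in class `C`" assembled STRICTLY from published theorems — so
that the rank-`≤ 1` remainder becomes exactly the CONSTRUCTION-SHAPED classes, which are TYPED
(missing-input `Prop`s), NOT attempted.  This is not "finishing BSD".  Nothing here is booked; no
mark / label / count / tier moves; X11b @ `p` stays OPEN / CONSTRUCTION-SHAPED (Kolyvagin bounds
`Ш` relative to the Heegner index — ONE inequality towards clause (iii) of `BSDp W p`, not `BSD_p`).

WHAT THIS FILE DOES.  Every ORDER form of the x11b3 Kolyvagin telescope so far bounds `Ш(E/K)[p^∞]`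
over the Heegner FIELD `K` (`X11b/KolyvaginShaOrder*`, this GEN's (KN_p)-free
`card_sha_primary_le_at_of_gross1991E0[_index]_of_localDuality_of_prop37`); the ℚ-side files
(`Three/KolyvaginShaThreeDescentToQ`, `…Rat*`) descend finiteness / annihilators only («the ORDER
form is NOT obtained», FILE D).  THIS FILE descends the ORDER data: §1 a fact-free lemma — for
`K/ℚ` Galois of degree prime to `p`, restriction `res : Ш(X/ℚ) → Ш(X_K/K)` maps the `p`-primary
part into the `p`-primary part INJECTIVELY (tree `shaRestriction_eq_zero_iff_of_coprime`: `res ∘ cor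
= [K : ℚ]`), so `Ш(X/ℚ)[p^∞]` is finite when `Ш(X_K/K)[p^∞]` is, `#Ш(X/ℚ)[p^∞] ∣ #Ш(X_K/K)[p^∞]`
(Lagrange, `AddSubgroup.card_dvd_of_injective`), hence `# ≤` and `ord_p # ≤` descend, and the
annihilator descends (FILE D); §2 the (KN_p)-free K-side ORDER END of this GEN (`M₀`-form)
descended along §1 at `[K : ℚ] = 2`.  Net (honest): for `E/ℚ` globally minimal without CM at
`N = N_E`, `K` imaginary quadratic Heegner with `d_K ∉ {−3, −4}`, a non-torsion Heegner point `y_K`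
with `p^{M₀} x₀ = y_K ∉ p^{M₀+1} E(K)` (`M₀ = ord_p [E(K) : ℤ y_K]` when the index is finite,
McCallum Lemma 5.1), `p` odd with `ρ̄_{E,p}` onto — NO condition on Tamagawa numbers / Kodaira
types: `Ш(E/ℚ)[p^∞]` is finite, killed by `p^{M₀}`, of order `≤ p^{2M₀}`, `ord_p # ≤ 2M₀` —
CONDITIONAL on the TWO NAMED PUBLISHED facts {`GrossLMS1991.prop37_2_reductionCongruence N W K p`,
`Gross1991_heegnerPoint_sub_ratTorsion_mem_E0`} + the displayed Cassels–Tate inputs; neither fact discharged; the CITED statements `kolyvagin` /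
`Kolyvagin1990_padicValNat_card_sha_le` neither used nor discharged; nothing booked.

## What is proved

* `KolyvaginAssembly.sha_primary_order_of_baseChange_of_coprime` — §1, fact-free descent of the
  four-part ORDER data (finite ∧ `p^{M₀}`-torsion ∧ `# ≤ B` ∧ `ord_p # ≤ v`) from `Ш(X_K/K)[p^∞]` to
  `Ш(X/ℚ)[p^∞]` for `K/ℚ` Galois of degree prime to `p`.
* `KolyvaginDischarged.card_sha_rat_primary_le_of_gross1991E0_of_localDuality_of_prop37` — the
  `M₀`-form over `ℚ` (`p^{M₀} x₀ = y_K ∉ p^{M₀+1} E(K)`, `M₀ ≥ 1`); the Heegner-INDEX currency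
  (`M₀ = ord_p [E(K) : ℤ y_K]`, McCallum Lemma 5.1) descends the same way from the K-side INDEX END
  (`X11b/KolyvaginShaOrderAtPrimeIndexOfGross1991`, this GEN, review lane at the time of writing).

## References

* [McCallumLMS1991] W. G. McCallum, LMS LNS 153 (1991), §1 Theorem (Kolyvagin), Lemma 5.1, Cor. 5.6.
  [GrossLMS1991] Thm. 1.3 (2), §2 Prop. 2.1 (2), Thm. 2.2 (2), §3 Prop. 3.7 (2), §6 Prop. 6.2 (1).
  [GrossZagier1986Heegner] III (3.1).  [SerreGaloisCohomology1997] I.§2.4 (res ∘ cor).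
* [MilneADT2006] Ch. I §6, Thm. 6.13 (a).

presearch: `rg "ORDER form is NOT obtained" X11b/Three/KolyvaginShaThreeDescentToQ.lean` (FILE D's
scope note); `lean search 'card_sha_rat_primary_le'` → none before this GEN; Mathlib
`AddSubgroup.card_dvd_of_injective`, `Nat.card_le_card_of_injective`, `padicValNat_dvd_iff_le`;
nothing minted.
-/

noncomputable section

open scoped Classical
open WeierstrassCurve Field NumberField IsDedekindDomain Function
open Literature.NumberTheory.EllipticCurves Literature.NumberTheory.GaloisRepresentations
open Literature.NumberTheory.EllipticCurves.RingClassField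
open Literature.NumberTheory.EllipticCurves.ModularForms
open Literature.NumberTheory.DiophantineGeometry Literature.NumberTheory.DiophantineGeometry.TateAlgorithm
open Literature.NumberTheory.GaloisCohomology
open Literature.NumberTheory.GaloisRepresentations.DiscreteGaloisModule (mu MuCarrier)
open Literature.NumberTheory.EllipticCurves.GrossLMS1991 (prop37_2_reductionCongruence)

/-! ### §1 Descent of ORDER data `Ш(X_K/K)[p^∞] → Ш(X/ℚ)[p^∞]`, `p ∤ [K : ℚ]` (fact-free) -/

namespace Summit.BirchSwinnertonDyer.Rank1Residual.X11b.KolyvaginAssembly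

variable (X : WeierstrassCurve ℚ) (K : Type) [Field K] [NumberField K] [IsGalois ℚ K] {p : ℕ}

/-- **ORDER data descend from `K` to `ℚ` for `K/ℚ` Galois of degree prime to `p`.**  If
`Ш(X_K/K)[p^∞]` is finite, killed by `p^{M₀}`, of order `≤ B` with `ord_p # ≤ v`, then the same four
hold for `Ш(X/ℚ)[p^∞]`: restriction `res : Ш(X/ℚ) → Ш(X_K/K)` maps `p`-primary classes to
`p`-primary classes and is INJECTIVE there (`res c = 0`, `p^j c = 0` ⟹ `[K : ℚ] c = 0` by `res ∘ cor`,
and `gcd(p^j, [K : ℚ]) = 1`; tree `shaRestriction_eq_zero_iff_of_coprime`), so finiteness and `# ≤`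
pull back (`Nat.card_le_card_of_injective`), `#Ш(X/ℚ)[p^∞] ∣ #Ш(X_K/K)[p^∞]` (Lagrange,
`AddSubgroup.card_dvd_of_injective`) gives `ord_p`-monotonicity (`padicValNat_dvd_iff_le`), and the
annihilator descends by `pow_smul_sha_primary_eq_zero_of_baseChange_of_coprime`.  Pure group
cohomology bookkeeping; no elliptic-curve input beyond the restriction map.
[cite: SerreGaloisCohomology1997, I.§2.4 Cor. to Prop. 9] -/
theorem sha_primary_order_of_baseChange_of_coprime (hp : p.Prime)
    (hcop : p.Coprime (Module.finrank ℚ K)) {M₀ B v : ℕ}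
    (h : Finite (AddCommGroup.primaryComponent (X.baseChange K).sha p) ∧
      (∀ c ∈ AddCommGroup.primaryComponent (X.baseChange K).sha p, p ^ M₀ • c = 0) ∧
      Nat.card (AddCommGroup.primaryComponent (X.baseChange K).sha p) ≤ B ∧
      padicValNat p (Nat.card (AddCommGroup.primaryComponent (X.baseChange K).sha p)) ≤ v) :
    Finite (AddCommGroup.primaryComponent X.sha p) ∧
      (∀ c ∈ AddCommGroup.primaryComponent X.sha p, p ^ M₀ • c = 0) ∧
      Nat.card (AddCommGroup.primaryComponent X.sha p) ≤ B ∧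
      padicValNat p (Nat.card (AddCommGroup.primaryComponent X.sha p)) ≤ v := by
  obtain ⟨hfin, hann, hcard, hval⟩ := h
  haveI := hfin
  haveI : Fact p.Prime := ⟨hp⟩
  -- the restriction on `p`-primary components
  have hmem : ∀ c ∈ AddCommGroup.primaryComponent X.sha p,
      shaRestriction X K c ∈ AddCommGroup.primaryComponent (X.baseChange K).sha p := fun c hc ↦ by
    obtain ⟨j, hj⟩ := AddCommGroup.mem_primaryComponent.mp hc
    exact AddCommGroup.mem_primaryComponent.mpr ⟨j, by rw [← map_nsmul, hj, map_zero]⟩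
  let f : AddCommGroup.primaryComponent X.sha p →+ AddCommGroup.primaryComponent (X.baseChange K).sha p :=
    ((shaRestriction X K).comp (AddCommGroup.primaryComponent X.sha p).subtype).codRestrict _
      fun c ↦ hmem c.1 c.2
  have hinj : Function.Injective f := by
    intro a b hab
    apply Subtype.ext
    obtain ⟨j₁, hj₁⟩ := AddCommGroup.mem_primaryComponent.mp a.2
    obtain ⟨j₂, hj₂⟩ := AddCommGroup.mem_primaryComponent.mp b.2
    have hn : (p ^ (j₁ + j₂)).Coprime (Module.finrank ℚ K) := Nat.Coprime.pow_left _ hcop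
    have h1 : p ^ (j₁ + j₂) • (a : X.sha) = 0 := by rw [pow_add, mul_comm, mul_smul, hj₁, smul_zero]
    have h2 : p ^ (j₁ + j₂) • (b : X.sha) = 0 := by rw [pow_add, mul_smul, hj₂, smul_zero]
    have hkill : p ^ (j₁ + j₂) • ((a : X.sha) - b) = 0 := by rw [nsmul_sub, h1, h2, sub_zero]
    have hab' : shaRestriction X K (a : X.sha) = shaRestriction X K (b : X.sha) :=
      congrArg Subtype.val hab
    have h0 : shaRestriction X K ((a : X.sha) - b) = 0 := by rw [map_sub, hab', sub_self]
    exact sub_eq_zero.mp ((shaRestriction_eq_zero_iff_of_coprime X K hn _ hkill).mp h0)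
  haveI hfinQ : Finite (AddCommGroup.primaryComponent X.sha p) := Finite.of_injective f hinj
  refine ⟨hfinQ, fun c hc ↦ ?_, (Nat.card_le_card_of_injective f hinj).trans hcard, ?_⟩
  · exact pow_smul_sha_primary_eq_zero_of_baseChange_of_coprime X K hcop
      (fun c' hc' ↦ hann c' (AddCommGroup.mem_primaryComponent.mpr hc')) c
      (AddCommGroup.mem_primaryComponent.mp hc)
  · -- `#Ш(X/ℚ)[p^∞] ∣ #Ш(X_K/K)[p^∞]`, so `ord_p` is monotone
    have hdvd : Nat.card (AddCommGroup.primaryComponent X.sha p) ∣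
        Nat.card (AddCommGroup.primaryComponent (X.baseChange K).sha p) :=
      AddSubgroup.card_dvd_of_injective f hinj
    have h0 : Nat.card (AddCommGroup.primaryComponent (X.baseChange K).sha p) ≠ 0 := Nat.card_pos.ne'
    have hle : padicValNat p (Nat.card (AddCommGroup.primaryComponent X.sha p)) ≤
        padicValNat p (Nat.card (AddCommGroup.primaryComponent (X.baseChange K).sha p)) :=
      (padicValNat_dvd_iff_le h0).mp (pow_padicValNat_dvd.trans hdvd)
    exact hle.trans hval

end Summit.BirchSwinnertonDyer.Rank1Residual.X11b.KolyvaginAssembly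

/-! ### §2 The (KN_p)-free ORDER END over `ℚ` -/

namespace Summit.BirchSwinnertonDyer.Rank1Residual.X11b.KolyvaginDischarged

open Summit.BirchSwinnertonDyer.Rank1Residual.X11b.KolyvaginAssembly

-- `LocallyCompactSpace Γ_K` / `CharZero` of completions, as in the tree's Cassels–Tate files.
attribute [local instance] absoluteGaloisGroup_compactSpace charZero_placeCompletion

-- `K : Type`: the tree's ring-class class field theory is universe `0`.
variable {K : Type} [Field K] [NumberField K] {N : ℕ} {W : WeierstrassCurve ℚ}

/-- **Kolyvagin's order bound over `ℚ` at ONE odd surjective prime `p`, `M₀`-form — NO Kodaira–Néron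
hypothesis: `Ш(E/ℚ)[p^∞]` finite ∧ `p^{M₀}`-torsion ∧ `#Ш(E/ℚ)[p^∞] ≤ p^{2M₀}` ∧ `ord_p # ≤ 2M₀` —
modulo the TWO NAMED facts and the Cassels–Tate inputs** — for `p^{M₀} x₀ = y_K ∉ p^{M₀+1}E(K)`,
`M₀ ≥ 1`.  The K-side END `card_sha_primary_le_at_of_gross1991E0_of_localDuality_of_prop37`
descended by §1 at `[K : ℚ] = 2` (`hK.1`) prime to `p`.  Binders VERBATIM the K-side END's;
conclusion the same four clauses for `W.sha` (over `ℚ`).  CONDITIONAL on EXACTLY the two named facts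
(PUBLISHED, NOT discharged) + `hN` + the Cassels–Tate inputs; nothing booked; no mark / count / tier
moves. [cite: McCallumLMS1991, §1 Theorem (Kolyvagin), Cor. 5.6]
[cite: GrossLMS1991, Thm. 2.2 (2), §3 Prop. 3.7 (2), §6 Prop. 6.2 (1)] [cite: SerreGaloisCohomology1997, I.§2.4]
[cite: MilneADT2006, Ch. I §6, Thm. 6.13(a)] -/
theorem card_sha_rat_primary_le_of_gross1991E0_of_localDuality_of_prop37 [NeZero N]
    [W.IsGloballyMinimal] {p : ℕ} (hp : p.Prime) (hp2 : p ≠ 2)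
    (hN : ∀ [W.IsElliptic], N = W.conductorNorm ℤ)
    (hE0 : Gross1991_heegnerPoint_sub_ratTorsion_mem_E0)
    (hγ : prop37_2_reductionCongruence N W K p) :
    ∀ [W.IsElliptic] (_hE : ¬ W.HasCM) (_hK : IsImaginaryQuadratic K)
      (_hD : NumberField.discr K ≠ -3 ∧ NumberField.discr K ≠ -4)
      (_hH : SatisfiesHeegnerHypothesis N K)
      {P : (W.baseChange K).toAffine.Point} (_hP : IsHeegnerPoint N W K P)
      (_hnt : ¬ IsOfFinAddOrder P) (_hρ : W.HasSurjectiveModNGaloisRep p)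
      {M₀ : ℕ} (_hM₀ : 1 ≤ M₀) [NeZero (p ^ M₀)] {c : K ≃ₐ[ℚ] K} (_hc : c ≠ 1) (_hcc : c * c = 1)
      {x₀ : (W.baseChange K).toAffine.Point} (_hx₀ : p ^ M₀ • x₀ = P)
      (_hmax : ∀ Q : (W.baseChange K).toAffine.Point, p ^ (M₀ + 1) • Q ≠ P)
      (e : geomTorsion (W.baseChange K) ((p ^ M₀ * p ^ M₀ : ℕ) : ℤ) →
        geomTorsion (W.baseChange K) ((p ^ M₀ * p ^ M₀ : ℕ) : ℤ) → AlgebraicClosure K)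
      (hμ : ∀ S T, e S T ^ (p ^ M₀ * p ^ M₀) = 1)
      (hadd₁ : ∀ S₁ S₂ T, e (S₁ + S₂) T = e S₁ T * e S₂ T)
      (hadd₂ : ∀ S T₁ T₂, e S (T₁ + T₂) = e S T₁ * e S T₂)
      (hgal : ∀ (σ : absoluteGaloisGroup K) (S T : geomTorsion (W.baseChange K) ((p ^ M₀ * p ^ M₀ : ℕ) : ℤ)),
        σ • e S T = e (σ • S) (σ • T))
      (halt : ∀ T, e T T = 1) (hnondeg : ∀ T, (∀ S, e S T = 1) → T = 0)
      (inv : LocalInvariants K (p ^ M₀ * p ^ M₀)) (hPT' : inv.SumInvLocalizationEqZero)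
      (hinv : ∀ v : HeightOneSpectrum (𝓞 K), Injective (inv (Sum.inr v)))
      (hH3 : ∀ x : galoisCohomology (mu K (p ^ M₀ * p ^ M₀)) 3,
        (∀ v : Place K, galoisCohomology.localization (mu K (p ^ M₀ * p ^ M₀)) v 3 x = 0) → x = 0)
      (hB : Literature.GroupTheory.FiniteAbelian.IsLevelPairing (p ^ M₀)
        (ctLevelPairing (W.baseChange K) (p ^ M₀) e hμ hadd₁ hadd₂ hgal inv halt hPT' hH3
          (localTerm_finite_support (W := W.baseChange K) (m := p ^ M₀) (e := e) (hμ := hμ)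
            (hadd₁ := hadd₁) (hadd₂ := hadd₂) (hgal := hgal) halt inv)))
      (hPτ : ∀ z ∈ selmerGroup (W.baseChange K) ((p ^ M₀ * p ^ M₀ : ℕ) : ℤ),
        ∀ t ∈ selmerGroup (W.baseChange K) ((p ^ M₀ * p ^ M₀ : ℕ) : ℤ),
        ctGeneralFun (W.baseChange K) (p ^ M₀) e hμ hadd₁ hadd₂ hgal inv
            (torsionH1ToH1 (W.baseChange K) _ (conjAct W c _ z))
            (torsionH1ToH1 (W.baseChange K) _ (conjAct W c _ t)) =
          ctGeneralFun (W.baseChange K) (p ^ M₀) e hμ hadd₁ hadd₂ hgal inv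
            (torsionH1ToH1 (W.baseChange K) _ z) (torsionH1ToH1 (W.baseChange K) _ t)),
      Finite (AddCommGroup.primaryComponent W.sha p) ∧
      (∀ c ∈ AddCommGroup.primaryComponent W.sha p, p ^ M₀ • c = 0) ∧
      Nat.card (AddCommGroup.primaryComponent W.sha p) ≤ p ^ (2 * M₀) ∧
      padicValNat p (Nat.card (AddCommGroup.primaryComponent W.sha p)) ≤ 2 * M₀ := by
  intro _ hE hK hD hH P hP hnt hρ M₀ hM₀ _ c hc hcc x₀ hx₀ hmax e hμ hadd₁ hadd₂ hgal halt hnondeg inv hPT' hinv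
    hH3 hB hPτ
  haveI : Algebra.IsQuadraticExtension ℚ K := ⟨hK.1⟩
  have hcop : p.Coprime (Module.finrank ℚ K) := by
    rw [hK.1]; exact (Nat.coprime_primes hp Nat.prime_two).mpr hp2
  exact sha_primary_order_of_baseChange_of_coprime W K hp hcop
    (card_sha_primary_le_at_of_gross1991E0_of_localDuality_of_prop37 hp hp2 hN hE0 hγ hE hK hD hH hP hnt hρ
      hM₀ hc hcc hx₀ hmax e hμ hadd₁ hadd₂ hgal halt hnondeg inv hPT' hinv hH3 hB hPτ)

/-- **McCallum 1991 §1 Theorem (Kolyvagin) OVER `ℚ` at ONE odd surjective prime `p`, Heegner-INDEX form: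
`ord_p #Ш(E/ℚ)[p^∞] ≤ 2 · ord_p [E(K) : ℤ y_K]`** (for `[E(K) : ℤ y_K]` finite, `_hidx`), together
with: `Ш(E/ℚ)[p^∞]` finite, killed by `p^{M₀}`, of order `≤ p^{2M₀}`, `M₀ = ord_p [E(K) : ℤ y_K]` — NO
Kodaira–Néron hypothesis.  The K-side INDEX END
`card_sha_primary_le_at_of_gross1991E0_index_of_localDuality_of_prop37`
(`X11b/KolyvaginShaOrderAtPrimeIndexOfGross1991`) descended by §1 at `[K : ℚ] = 2` prime to `p`.
This is the shape in which the Kolyvagin half of the `p`-part of BSD over `ℚ` is consumed (with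
Gross–Zagier's index relation), MODULO the two NAMED facts + `hN` + the Cassels–Tate inputs; the
named fact `Kolyvagin1990_padicValNat_card_sha_le` is neither used nor discharged; nothing booked;
no mark / count / tier moves (appended, x11b3-p2 GEN 54; previous declarations byte-identical).
[cite: McCallumLMS1991, §1 Theorem (Kolyvagin), Lemma 5.1 (p. 303), Cor. 5.6]
[cite: GrossLMS1991, §2 Prop. 2.1 (2), Thm. 2.2 (2), §3 Prop. 3.7 (2), §6 Prop. 6.2 (1)]
[cite: SerreGaloisCohomology1997, I.§2.4] [cite: MilneADT2006, Ch. I §6, Thm. 6.13(a)] -/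
theorem card_sha_rat_primary_le_of_gross1991E0_index_of_localDuality_of_prop37 [NeZero N]
    [W.IsGloballyMinimal] {p : ℕ} (hp : p.Prime) (hp2 : p ≠ 2)
    (hN : ∀ [W.IsElliptic], N = W.conductorNorm ℤ)
    (hE0 : Gross1991_heegnerPoint_sub_ratTorsion_mem_E0)
    (hγ : prop37_2_reductionCongruence N W K p) :
    ∀ [W.IsElliptic] (_hE : ¬ W.HasCM) (_hK : IsImaginaryQuadratic K)
      (_hD : NumberField.discr K ≠ -3 ∧ NumberField.discr K ≠ -4)
      (_hH : SatisfiesHeegnerHypothesis N K)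
      {P : (W.baseChange K).toAffine.Point} (_hP : IsHeegnerPoint N W K P)
      (_hnt : ¬ IsOfFinAddOrder P) (_hρ : W.HasSurjectiveModNGaloisRep p)
      (_hidx : (AddSubgroup.zmultiples P).index ≠ 0)
      {M₀ : ℕ} (_hv : padicValNat p (AddSubgroup.zmultiples P).index = M₀) [NeZero (p ^ M₀)]
      {c : K ≃ₐ[ℚ] K} (_hc : c ≠ 1) (_hcc : c * c = 1)
      (e : geomTorsion (W.baseChange K) ((p ^ M₀ * p ^ M₀ : ℕ) : ℤ) →
        geomTorsion (W.baseChange K) ((p ^ M₀ * p ^ M₀ : ℕ) : ℤ) → AlgebraicClosure K)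
      (hμ : ∀ S T, e S T ^ (p ^ M₀ * p ^ M₀) = 1)
      (hadd₁ : ∀ S₁ S₂ T, e (S₁ + S₂) T = e S₁ T * e S₂ T)
      (hadd₂ : ∀ S T₁ T₂, e S (T₁ + T₂) = e S T₁ * e S T₂)
      (hgal : ∀ (σ : absoluteGaloisGroup K) (S T : geomTorsion (W.baseChange K) ((p ^ M₀ * p ^ M₀ : ℕ) : ℤ)),
        σ • e S T = e (σ • S) (σ • T))
      (halt : ∀ T, e T T = 1) (hnondeg : ∀ T, (∀ S, e S T = 1) → T = 0)
      (inv : LocalInvariants K (p ^ M₀ * p ^ M₀)) (hPT' : inv.SumInvLocalizationEqZero)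
      (hinv : ∀ v : HeightOneSpectrum (𝓞 K), Injective (inv (Sum.inr v)))
      (hH3 : ∀ x : galoisCohomology (mu K (p ^ M₀ * p ^ M₀)) 3,
        (∀ v : Place K, galoisCohomology.localization (mu K (p ^ M₀ * p ^ M₀)) v 3 x = 0) → x = 0)
      (hB : Literature.GroupTheory.FiniteAbelian.IsLevelPairing (p ^ M₀)
        (ctLevelPairing (W.baseChange K) (p ^ M₀) e hμ hadd₁ hadd₂ hgal inv halt hPT' hH3
          (localTerm_finite_support (W := W.baseChange K) (m := p ^ M₀) (e := e) (hμ := hμ)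
            (hadd₁ := hadd₁) (hadd₂ := hadd₂) (hgal := hgal) halt inv)))
      (hPτ : ∀ z ∈ selmerGroup (W.baseChange K) ((p ^ M₀ * p ^ M₀ : ℕ) : ℤ),
        ∀ t ∈ selmerGroup (W.baseChange K) ((p ^ M₀ * p ^ M₀ : ℕ) : ℤ),
        ctGeneralFun (W.baseChange K) (p ^ M₀) e hμ hadd₁ hadd₂ hgal inv
            (torsionH1ToH1 (W.baseChange K) _ (conjAct W c _ z))
            (torsionH1ToH1 (W.baseChange K) _ (conjAct W c _ t)) =
          ctGeneralFun (W.baseChange K) (p ^ M₀) e hμ hadd₁ hadd₂ hgal inv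
            (torsionH1ToH1 (W.baseChange K) _ z) (torsionH1ToH1 (W.baseChange K) _ t)),
      Finite (AddCommGroup.primaryComponent W.sha p) ∧
      (∀ c ∈ AddCommGroup.primaryComponent W.sha p, p ^ M₀ • c = 0) ∧
      Nat.card (AddCommGroup.primaryComponent W.sha p) ≤ p ^ (2 * M₀) ∧
      padicValNat p (Nat.card (AddCommGroup.primaryComponent W.sha p)) ≤ 2 * M₀ := by
  intro _ hE hK hD hH P hP hnt hρ hidx M₀ hv _ c hc hcc e hμ hadd₁ hadd₂ hgal halt hnondeg inv hPT' hinv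
    hH3 hB hPτ
  haveI : Algebra.IsQuadraticExtension ℚ K := ⟨hK.1⟩
  have hcop : p.Coprime (Module.finrank ℚ K) := by
    rw [hK.1]; exact (Nat.coprime_primes hp Nat.prime_two).mpr hp2
  exact sha_primary_order_of_baseChange_of_coprime W K hp hcop
    (card_sha_primary_le_at_of_gross1991E0_index_of_localDuality_of_prop37 hp hp2 hN hE0 hγ hE hK hD hH
      hP hnt hρ hidx hv hc hcc e hμ hadd₁ hadd₂ hgal halt hnondeg inv hPT' hinv hH3 hB hPτ)

end Summit.BirchSwinnertonDyer.Rank1Residual.X11b.KolyvaginDischarged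

end
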